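import Literature.Topology.FourManifolds.OneMaxBall
import HarnessLib

/-!
# Height functions on embedded surfaces: the dictionary with a defining function

Topic `Literature/Topology/FourManifolds`; fact seat of Alexander's theorem
(`provefact-Literature.Topology.FourManifolds.SphereEmbedding.schoenflies_exists_ball`, Schultens
(2014), Thm. 3.2.5).  **Everything in this file is proved; no definitions, no named facts.**

Alexander's argument (Schultens (2014), PDF pp. 43–45) is phrased with the Morse data of the
height function `h|S` of the sphere `S` — its critical points, their indices (minimum / saddle /
maximum) and their number of saddles `n` — while the moves of the fact seat's induction act on a
defining function `F` of the solid `A = {F ≤ 0}` bounded by `S = {F = 0}`.  This file completes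
the dictionary between the two descriptions begun in `HeightTwoCriticalBall.lean`
(`isMCriticalPt_inner_comp_iff`: critical ⇔ horizontal normal;
`separating_fderiv_fderiv_of_nondegenerate_mhessian`) and `OneMaxBall.lean`
(`hessianInChart_inner_comp_apply`: `Hess ⟪v, f ·⟫ = -c⁻¹ D²F(df ·, df ·)`):

* `HeightDictionary.sigNeg_eq_one_iff` — on a plane, a nondegenerate symmetric form has negative
  index of inertia `1` iff it is indefinite (with `one_le_sigNeg_of_apply_self_neg`,
  `sigNeg_add_one_le_of_apply_self_pos`);
* `HeightDictionary.exists_mfderiv_eq_iff_inner_eq_zero` — `im df_x = vᗮ` at a horizontal point;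
* `HeightDictionary.nondegenerate_mhessian_inner_comp_iff` — the Hessian of the height is
  nondegenerate iff `D²F|vᗮ` is (both directions);
* `HeightDictionary.morseIndex_inner_comp_eq_one_iff` — for surfaces in `3`-space, Morse index
  `1` (saddle) iff `D²F|vᗮ` is indefinite, whatever the sign of `c`;
* `HeightDictionary.isMorse_inner_comp_iff`, `criticalSet_inner_comp_eq_preimage`,
  `criticalSetOfIndex_one_eq_preimage`, `ncard_criticalSetOfIndex_one_eq` — the height is Morse
  iff every horizontal point is nondegenerate; the critical set, the saddles and the number of
  saddles read off on the hypersurface.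

## References

* J. Schultens, *Introduction to 3-Manifolds*, GSM 151 (2014), proof of Thm. 3.2.5 (PDF
  pp. 43–45). [Schultens2014]
* J. Milnor, *Morse theory*, Ann. of Math. Studies 51 (1963), §2. [Milnor1963]
-/

open scoped RealInnerProductSpace Topology Manifold ContDiff
open Set Filter Metric Module Function

noncomputable section

namespace Literature.Topology.FourManifolds

namespace HeightDictionary

open ExpHeight

/-! ### §1 Nondegenerate symmetric forms on a plane: index one means indefinite -/

section Forms

variable {V : Type*} [AddCommGroup V] [Module ℝ V] [FiniteDimensional ℝ V]

/-- A vector of negative square forces negative index of inertia `≥ 1`. [folklore] -/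
theorem one_le_sigNeg_of_apply_self_neg (B : LinearMap.BilinForm ℝ V) {a : V} (ha : B a a < 0) :
    1 ≤ sigNeg B.toQuadraticMap := by
  have ha0 : a ≠ 0 := by
    rintro rfl
    simp at ha
  have hdim : finrank ℝ (ℝ ∙ a) = 1 := finrank_span_singleton ha0
  rw [← hdim]
  refine le_sigNeg_of_negDef B.toQuadraticMap (V := ℝ ∙ a) ?_
  intro x hx
  obtain ⟨t, ht⟩ := Submodule.mem_span_singleton.1 x.2
  have ht0 : t ≠ 0 := by
    rintro rfl
    apply hx
    ext1
    rw [zero_smul] at ht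
    simp [← ht]
  have hx' : (x : V) = t • a := ht.symm
  simp only [QuadraticMap.restrict_apply, QuadraticMap.neg_apply,
    LinearMap.BilinMap.toQuadraticMap_apply, hx', map_smul, LinearMap.smul_apply, smul_eq_mul]
  have : 0 < t * t := mul_self_pos.2 ht0
  nlinarith

/-- A vector of positive square forces negative index of inertia `≤ dim V - 1`. [folklore] -/
theorem sigNeg_add_one_le_of_apply_self_pos (B : LinearMap.BilinForm ℝ V) {b : V}
    (hb : 0 < B b b) : sigNeg B.toQuadraticMap + 1 ≤ finrank ℝ V := by
  have hb0 : b ≠ 0 := by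
    rintro rfl
    simp at hb
  have hdim : finrank ℝ (ℝ ∙ b) = 1 := finrank_span_singleton hb0
  have hW : ∀ u ∈ ℝ ∙ b, 0 ≤ B u u := by
    intro u hu
    obtain ⟨t, rfl⟩ := Submodule.mem_span_singleton.1 hu
    simp only [map_smul, LinearMap.smul_apply, smul_eq_mul]
    have : 0 ≤ t * t := mul_self_nonneg t
    nlinarith
  have h := QuadraticForm.sigPos_add_finrank_le_of_nonpos (Q := -B.toQuadraticMap) (V := ℝ ∙ b)
    (fun u hu => by
      rw [QuadraticMap.neg_apply, neg_nonpos, LinearMap.BilinMap.toQuadraticMap_apply]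
      exact hW u hu)
  rw [sigPos_neg, hdim] at h
  exact h

/-- **On a plane, a nondegenerate symmetric form has negative index of inertia `1` iff it is
indefinite** (takes both signs). [folklore] -/
theorem sigNeg_eq_one_iff (hV : finrank ℝ V = 2) (B : LinearMap.BilinForm ℝ V)
    (hsym : ∀ a b, B a b = B b a) (hnd : ∀ a, (∀ b, B a b = 0) → a = 0) :
    sigNeg B.toQuadraticMap = 1 ↔ (∃ a, B a a < 0) ∧ ∃ b, 0 < B b b := by
  constructor
  · intro h1
    refine ⟨?_, ExpHeight.exists_apply_self_pos_of_sigNeg_lt B hsym hnd (by omega)⟩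
    have hB : B.Nondegenerate :=
      ⟨fun a ha => hnd a ha, fun a ha => hnd a fun b => by rw [hsym]; exact ha b⟩
    have hs : LinearMap.IsSymm B := ⟨fun a b => hsym a b⟩
    have hsum := sigPos_add_sigNeg_of_nondegenerate_of_isSymm hB hs
    rw [h1, hV] at hsum
    have hQ : (-B).toQuadraticMap = -B.toQuadraticMap := by
      ext x
      simp
    have hneg : sigNeg (-B).toQuadraticMap < finrank ℝ V := by
      rw [hQ, sigNeg_neg, hV]
      omega
    obtain ⟨a, ha⟩ := ExpHeight.exists_apply_self_pos_of_sigNeg_lt (-B)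
      (fun a b => by simp [hsym a b]) (fun a ha => hnd a fun b => by simpa using ha b) hneg
    exact ⟨a, by simpa using ha⟩
  · rintro ⟨⟨a, ha⟩, ⟨b, hb⟩⟩
    have h1 := one_le_sigNeg_of_apply_self_neg B ha
    have h2 := sigNeg_add_one_le_of_apply_self_pos B hb
    omega

/-- Sign bookkeeping: multiplying a real quadratic quantity by a nonzero constant permutes the
two conditions "takes a negative value" and "takes a positive value". [folklore] -/
theorem exists_neg_and_exists_pos_iff_of_ne_zero {α : Type*} {c : ℝ} (hc : c ≠ 0)
    (P : α → Prop) (Q : α → ℝ) :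
    ((∃ w, P w ∧ c * Q w < 0) ∧ ∃ w, P w ∧ 0 < c * Q w) ↔
      (∃ w, P w ∧ Q w < 0) ∧ ∃ w, P w ∧ 0 < Q w := by
  rcases lt_or_gt_of_ne hc with h | h
  · constructor
    · rintro ⟨⟨a, ha, ha'⟩, ⟨b, hb, hb'⟩⟩
      exact ⟨⟨b, hb, by nlinarith⟩, ⟨a, ha, by nlinarith⟩⟩
    · rintro ⟨⟨a, ha, ha'⟩, ⟨b, hb, hb'⟩⟩
      exact ⟨⟨b, hb, by nlinarith⟩, ⟨a, ha, by nlinarith⟩⟩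
  · constructor
    · rintro ⟨⟨a, ha, ha'⟩, ⟨b, hb, hb'⟩⟩
      exact ⟨⟨a, ha, by nlinarith⟩, ⟨b, hb, by nlinarith⟩⟩
    · rintro ⟨⟨a, ha, ha'⟩, ⟨b, hb, hb'⟩⟩
      exact ⟨⟨a, ha, by nlinarith⟩, ⟨b, hb, by nlinarith⟩⟩

end Forms

/-! ### §2 The dictionary: height function on the hypersurface ↔ defining function -/

section Dict

variable {m : ℕ} {M : Type*} [TopologicalSpace M] [ChartedSpace (EuclideanSpace ℝ (Fin m)) M]
  {E : Type*} [NormedAddCommGroup E] [InnerProductSpace ℝ E] [FiniteDimensional ℝ E]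

omit [FiniteDimensional ℝ E] in
/-- A nonzero multiple of `⟪v, ·⟫`, `v ≠ 0`, is a nonzero functional. [folklore] -/
theorem smul_innerSL_ne_zero {v : E} (hv : v ≠ 0) {c : ℝ} (hc : c ≠ 0) :
    c • innerSL ℝ v ≠ 0 := by
  intro h
  have := congrArg (fun A : E →L[ℝ] ℝ => A v) h
  simp only [FunLike.coe_smul, Pi.smul_apply, innerSL_apply_apply, smul_eq_mul,
    zero_apply, mul_eq_zero, real_inner_self_eq_norm_sq] at this
  rcases this with h1 | h1
  · exact hc h1
  · exact hv (by simpa using h1)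

/-- **The tangent space of the hypersurface at a horizontal point is `vᗮ`**: with `f`, `F` as in
`fderiv_apply_eq_zero_iff_exists_mfderiv_eq` and `DF(f x) = c ⟪v, ·⟫`, `c ≠ 0`, a vector is in
the image of `df_x` iff it is orthogonal to `v`. [folklore] -/
theorem exists_mfderiv_eq_iff_inner_eq_zero (hdim : finrank ℝ E = m + 1) {f : M → E} {x : M}
    (hf : MDifferentiableAt (𝓡 m) 𝓘(ℝ, E) f x)
    (hinj : Function.Injective (mfderiv (𝓡 m) 𝓘(ℝ, E) f x)) {F : E → ℝ}
    (hF : DifferentiableAt ℝ F (f x)) (hFf : ∀ y, F (f y) = 0) {v : E} (hv : v ≠ 0) {c : ℝ}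
    (hc : c ≠ 0) (hDF : fderiv ℝ F (f x) = c • innerSL ℝ v) (w : E) :
    (∃ a : EuclideanSpace ℝ (Fin m), mfderiv (𝓡 m) 𝓘(ℝ, E) f x a = w) ↔ ⟪v, w⟫ = 0 := by
  have hDF0 : fderiv ℝ F (f x) ≠ 0 := by rw [hDF]; exact smul_innerSL_ne_zero hv hc
  rw [← fderiv_apply_eq_zero_iff_exists_mfderiv_eq hdim hf hinj hF hFf hDF0 w, hDF]
  simp [hc]

/-- **Nondegeneracy dictionary.**  Let `f : M → E` be `C²` at `x` with injective differential
(`dim E = m + 1`), `F` a `C²` function vanishing on the range of `f` with `DF(f x) = c ⟪v, ·⟫`,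
`c ≠ 0`, `v ≠ 0` (so `x` is a critical point of the height `⟪v, f ·⟫`).  Then the Hessian of the
height at `x` is nondegenerate iff the second derivative `D²F(f x)` restricted to `vᗮ` is
nondegenerate (separating).  (`⇒` is the tree's
`separating_fderiv_fderiv_of_nondegenerate_mhessian`; `⇐` by the same formula
`Hess = -c⁻¹ D²F(df ·, df ·)`, `hessianInChart_inner_comp_apply`, and `im df = vᗮ`.) [folklore] -/
theorem nondegenerate_mhessian_inner_comp_iff [IsManifold (𝓡 m) 2 M] (hdim : finrank ℝ E = m + 1)
    {f : M → E} {x : M} (hf : ContMDiffAt (𝓡 m) 𝓘(ℝ, E) 2 f x)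
    (hinj : Function.Injective (mfderiv (𝓡 m) 𝓘(ℝ, E) f x)) {F : E → ℝ}
    (hF : ContDiffAt ℝ 2 F (f x)) (hFf : ∀ y, F (f y) = 0) {v : E} (hv : v ≠ 0) {c : ℝ}
    (hc : c ≠ 0) (hDF : fderiv ℝ F (f x) = c • innerSL ℝ v) :
    (mhessian (𝓡 m) (fun y => ⟪v, f y⟫) x).Nondegenerate ↔
      ∀ w, ⟪v, w⟫ = 0 → (∀ w', ⟪v, w'⟫ = 0 → fderiv ℝ (fderiv ℝ F) (f x) w w' = 0) → w = 0 := by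
  have hfd : MDifferentiableAt (𝓡 m) 𝓘(ℝ, E) f x := hf.mdifferentiableAt (by norm_num)
  have hFd : DifferentiableAt ℝ F (f x) := hF.differentiableAt (by norm_num)
  have hDF0 : fderiv ℝ F (f x) ≠ 0 := by rw [hDF]; exact smul_innerSL_ne_zero hv hc
  have hcrit : IsMCriticalPt (𝓡 m) (fun y => ⟪v, f y⟫) x :=
    (isMCriticalPt_inner_comp_iff hdim hfd hinj hFd hFf hDF0 hv).2 ⟨c, hDF⟩
  constructor
  · exact fun hnd =>
      separating_fderiv_fderiv_of_nondegenerate_mhessian hdim hf hinj hF hFf hDF0 hv hcrit hnd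
  · intro hsep
    set L : EuclideanSpace ℝ (Fin m) →L[ℝ] E := mfderiv (𝓡 m) 𝓘(ℝ, E) f x with hL
    have hformula : ∀ a b, mhessian (𝓡 m) (fun y => ⟪v, f y⟫) x a b =
        -c⁻¹ * fderiv ℝ (fderiv ℝ F) (f x) (L a) (L b) := fun a b => by
      rw [← hessianInChart_chartAt]
      exact hessianInChart_inner_comp_apply hf hF hFf hc hDF a b
    have hrange : ∀ w, ⟪v, w⟫ = 0 ↔ ∃ a, L a = w := fun w =>
      (exists_mfderiv_eq_iff_inner_eq_zero hdim hfd hinj hFd hFf hv hc hDF w).symm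
    have hLv : ∀ a, ⟪v, L a⟫ = 0 := fun a => (hrange _).2 ⟨a, rfl⟩
    have hsymm : ∀ w w', fderiv ℝ (fderiv ℝ F) (f x) w w' = fderiv ℝ (fderiv ℝ F) (f x) w' w :=
      fun w w' => hF.isSymmSndFDerivAt (by simp) w w'
    have hleft : ∀ a, (∀ b, mhessian (𝓡 m) (fun y => ⟪v, f y⟫) x a b = 0) → a = 0 := by
      intro a ha
      have h1 : ∀ w', ⟪v, w'⟫ = 0 → fderiv ℝ (fderiv ℝ F) (f x) (L a) w' = 0 := by
        intro w' hw'
        obtain ⟨b, rfl⟩ := (hrange w').1 hw'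
        have h2 := ha b
        rw [hformula] at h2
        rcases mul_eq_zero.1 h2 with h3 | h3
        · exact absurd h3 (neg_ne_zero.2 (inv_ne_zero hc))
        · exact h3
      have hLa : L a = 0 := hsep (L a) (hLv a) h1
      exact hinj (hLa.trans (map_zero L).symm)
    refine ⟨hleft, fun b hb => hleft b fun a => ?_⟩
    rw [hformula, hsymm, ← hformula]
    exact hb a

/-- **Index dictionary, surfaces in `3`-space: a critical point of the height is a saddle
(Morse index `1`) iff `D²F|vᗮ` is indefinite.**  With `f : M² → E³`, `F`, `v`, `c` as in
`nondegenerate_mhessian_inner_comp_iff` and `D²F(f x)|vᗮ` nondegenerate, the Morse index of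
`⟪v, f ·⟫` at `x` is `1` iff `D²F(f x)(w, w)` takes both signs on `vᗮ` (the Hessian of the
height is `-c⁻¹ D²F(df ·, df ·)` on the plane `im df = vᗮ`; on a plane a nondegenerate symmetric
form has negative index `1` iff it is indefinite, whatever the sign of `-c⁻¹`). [folklore] -/
theorem morseIndex_inner_comp_eq_one_iff {M : Type*} [TopologicalSpace M]
    [ChartedSpace (EuclideanSpace ℝ (Fin 2)) M] [IsManifold (𝓡 2) 2 M]
    (hdim : finrank ℝ E = 3) {f : M → E} {x : M} (hf : ContMDiffAt (𝓡 2) 𝓘(ℝ, E) 2 f x)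
    (hinj : Function.Injective (mfderiv (𝓡 2) 𝓘(ℝ, E) f x)) {F : E → ℝ}
    (hF : ContDiffAt ℝ 2 F (f x)) (hFf : ∀ y, F (f y) = 0) {v : E} (hv : v ≠ 0) {c : ℝ}
    (hc : c ≠ 0) (hDF : fderiv ℝ F (f x) = c • innerSL ℝ v)
    (hsep : ∀ w, ⟪v, w⟫ = 0 → (∀ w', ⟪v, w'⟫ = 0 → fderiv ℝ (fderiv ℝ F) (f x) w w' = 0) →
      w = 0) :
    morseIndex (𝓡 2) (fun y => ⟪v, f y⟫) x = 1 ↔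
      (∃ w, ⟪v, w⟫ = 0 ∧ fderiv ℝ (fderiv ℝ F) (f x) w w < 0) ∧
        ∃ w, ⟪v, w⟫ = 0 ∧ 0 < fderiv ℝ (fderiv ℝ F) (f x) w w := by
  have hfd : MDifferentiableAt (𝓡 2) 𝓘(ℝ, E) f x := hf.mdifferentiableAt (by norm_num)
  have hFd : DifferentiableAt ℝ F (f x) := hF.differentiableAt (by norm_num)
  set B := mhessian (𝓡 2) (fun y => ⟪v, f y⟫) x with hB
  have hnd : B.Nondegenerate :=
    (nondegenerate_mhessian_inner_comp_iff (m := 2) hdim hf hinj hF hFf hv hc hDF).2 hsep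
  set L : EuclideanSpace ℝ (Fin 2) →L[ℝ] E := mfderiv (𝓡 2) 𝓘(ℝ, E) f x with hL
  have hformula : ∀ a b, B a b = -c⁻¹ * fderiv ℝ (fderiv ℝ F) (f x) (L a) (L b) := fun a b => by
    rw [hB, ← hessianInChart_chartAt]
    exact hessianInChart_inner_comp_apply hf hF hFf hc hDF a b
  have hrange : ∀ w, ⟪v, w⟫ = 0 ↔ ∃ a, L a = w := fun w =>
    (exists_mfderiv_eq_iff_inner_eq_zero (m := 2) hdim hfd hinj hFd hFf hv hc hDF w).symm
  have hLv : ∀ a, ⟪v, L a⟫ = 0 := fun a => (hrange _).2 ⟨a, rfl⟩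
  have hsymmD : ∀ w w', fderiv ℝ (fderiv ℝ F) (f x) w w' = fderiv ℝ (fderiv ℝ F) (f x) w' w :=
    fun w w' => hF.isSymmSndFDerivAt (by simp) w w'
  have hsymB : ∀ a b, B a b = B b a := fun a b => by rw [hformula, hformula, hsymmD]
  have hV : finrank ℝ (EuclideanSpace ℝ (Fin 2)) = 2 := finrank_euclideanSpace_fin
  have key := sigNeg_eq_one_iff hV B hsymB hnd.1
  have hidx : morseIndex (𝓡 2) (fun y => ⟪v, f y⟫) x = sigNeg B.toQuadraticMap := rfl
  rw [hidx, key]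
  -- transfer the two sign conditions through `L` (onto `vᗮ`) and the factor `-c⁻¹`
  set Q : E → ℝ := fun w => fderiv ℝ (fderiv ℝ F) (f x) w w with hQ
  have hc' : -c⁻¹ ≠ 0 := neg_ne_zero.2 (inv_ne_zero hc)
  have h1 : ((∃ a, B a a < 0) ∧ ∃ b, 0 < B b b) ↔
      (∃ w, ⟪v, w⟫ = 0 ∧ -c⁻¹ * Q w < 0) ∧ ∃ w, ⟪v, w⟫ = 0 ∧ 0 < -c⁻¹ * Q w := by
    constructor
    · rintro ⟨⟨a, ha⟩, ⟨b, hb⟩⟩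
      exact ⟨⟨L a, hLv a, by rw [hformula] at ha; exact ha⟩,
        ⟨L b, hLv b, by rw [hformula] at hb; exact hb⟩⟩
    · rintro ⟨⟨w, hw, hw'⟩, ⟨w₁, hw₁, hw₁'⟩⟩
      obtain ⟨a, rfl⟩ := (hrange w).1 hw
      obtain ⟨b, rfl⟩ := (hrange w₁).1 hw₁
      exact ⟨⟨a, by rw [hformula]; exact hw'⟩, ⟨b, by rw [hformula]; exact hw₁'⟩⟩
  rw [h1]
  exact exists_neg_and_exists_pos_iff_of_ne_zero hc' (fun w => ⟪v, w⟫ = 0) Q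

/-- **Morse dictionary.**  Let `f : M → E` be smooth with injective differential everywhere
(`dim E = m + 1`) and `F` a `C²` function vanishing on its range with `DF ≠ 0` there, `v ≠ 0`.
Then the height `⟪v, f ·⟫` is a Morse function iff at every horizontal point `f x`
(`DF(f x) = c ⟪v, ·⟫`) the second derivative `D²F(f x)|vᗮ` is nondegenerate. [folklore] -/
theorem isMorse_inner_comp_iff [IsManifold (𝓡 m) 2 M] (hdim : finrank ℝ E = m + 1) {f : M → E}
    (hf : ContMDiff (𝓡 m) 𝓘(ℝ, E) ∞ f)
    (hinj : ∀ x, Function.Injective (mfderiv (𝓡 m) 𝓘(ℝ, E) f x)) {F : E → ℝ}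
    (hF : ContDiff ℝ 2 F) (hFf : ∀ y, F (f y) = 0) (hDF0 : ∀ y, fderiv ℝ F (f y) ≠ 0)
    {v : E} (hv : v ≠ 0) :
    IsMorse (𝓡 m) (fun y => ⟪v, f y⟫) ↔
      ∀ x (c : ℝ), fderiv ℝ F (f x) = c • innerSL ℝ v →
        ∀ w, ⟪v, w⟫ = 0 → (∀ w', ⟪v, w'⟫ = 0 → fderiv ℝ (fderiv ℝ F) (f x) w w' = 0) →
          w = 0 := by
  have hsmooth : ContMDiff (𝓡 m) 𝓘(ℝ, ℝ) ∞ (fun y => ⟪v, f y⟫) := fun x =>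
    (innerSL ℝ v).contDiff.contMDiff.contMDiffAt.comp x (hf x)
  have hfs : ∀ x, ContMDiffAt (𝓡 m) 𝓘(ℝ, E) 2 f x := fun x => (hf x).of_le (by norm_cast)
  have hfd : ∀ x, MDifferentiableAt (𝓡 m) 𝓘(ℝ, E) f x := fun x =>
    (hfs x).mdifferentiableAt (by norm_num)
  have hFx : ∀ x, ContDiffAt ℝ 2 F (f x) := fun x => hF.contDiffAt
  have hFd : ∀ x, DifferentiableAt ℝ F (f x) := fun x => (hFx x).differentiableAt (by norm_num)
  have hc_of : ∀ x (c : ℝ), fderiv ℝ F (f x) = c • innerSL ℝ v → c ≠ 0 := by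
    rintro x c hDF rfl
    rw [zero_smul] at hDF
    exact hDF0 x hDF
  constructor
  · intro hM x c hDF
    have hx : IsMCriticalPt (𝓡 m) (fun y => ⟪v, f y⟫) x :=
      (isMCriticalPt_inner_comp_iff hdim (hfd x) (hinj x) (hFd x) hFf (hDF0 x) hv).2 ⟨c, hDF⟩
    exact (nondegenerate_mhessian_inner_comp_iff hdim (hfs x) (hinj x) (hFx x) hFf hv
      (hc_of x c hDF) hDF).1 (hM.nondegenerate hx)
  · intro h
    refine ⟨hsmooth, fun x hx => ?_⟩
    obtain ⟨c, hDF⟩ :=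
      (isMCriticalPt_inner_comp_iff hdim (hfd x) (hinj x) (hFd x) hFf (hDF0 x) hv).1 hx
    exact (nondegenerate_mhessian_inner_comp_iff hdim (hfs x) (hinj x) (hFx x) hFf hv
      (hc_of x c hDF) hDF).2 (h x c hDF)

/-- **Critical set dictionary**: the critical points of the height `⟪v, f ·⟫` are exactly the
points mapped by `f` to horizontal points of the hypersurface (`DF ∥ ⟪v, ·⟫`). [folklore] -/
theorem criticalSet_inner_comp_eq_preimage (hdim : finrank ℝ E = m + 1) {f : M → E}
    (hfd : ∀ x, MDifferentiableAt (𝓡 m) 𝓘(ℝ, E) f x)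
    (hinj : ∀ x, Function.Injective (mfderiv (𝓡 m) 𝓘(ℝ, E) f x)) {F : E → ℝ}
    (hFd : ∀ x, DifferentiableAt ℝ F (f x)) (hFf : ∀ y, F (f y) = 0)
    (hDF0 : ∀ y, fderiv ℝ F (f y) ≠ 0) {v : E} (hv : v ≠ 0) :
    criticalSet (𝓡 m) (fun y => ⟪v, f y⟫) =
      f ⁻¹' {p | ∃ c : ℝ, fderiv ℝ F p = c • innerSL ℝ v} := by
  ext x
  rw [mem_criticalSet, mem_preimage, mem_setOf_eq]
  exact isMCriticalPt_inner_comp_iff hdim (hfd x) (hinj x) (hFd x) hFf (hDF0 x) hv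

/-- **Saddle dictionary, surfaces in `3`-space**: for `f : M² → E³` smooth with injective
differential, `F` a `C²` function vanishing on its range, regular there, with `D²F|vᗮ`
nondegenerate at every horizontal point, the index-`1` critical points of the height `⟪v, f ·⟫`
are exactly the points mapped to horizontal points where `D²F|vᗮ` is indefinite. [folklore] -/
theorem criticalSetOfIndex_one_eq_preimage {M : Type*} [TopologicalSpace M]
    [ChartedSpace (EuclideanSpace ℝ (Fin 2)) M] [IsManifold (𝓡 2) 2 M]
    (hdim : finrank ℝ E = 3) {f : M → E} (hf : ContMDiff (𝓡 2) 𝓘(ℝ, E) ∞ f)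
    (hinj : ∀ x, Function.Injective (mfderiv (𝓡 2) 𝓘(ℝ, E) f x)) {F : E → ℝ}
    (hF : ContDiff ℝ 2 F) (hFf : ∀ y, F (f y) = 0) (hDF0 : ∀ y, fderiv ℝ F (f y) ≠ 0)
    {v : E} (hv : v ≠ 0)
    (hsep : ∀ x (c : ℝ), fderiv ℝ F (f x) = c • innerSL ℝ v →
      ∀ w, ⟪v, w⟫ = 0 → (∀ w', ⟪v, w'⟫ = 0 → fderiv ℝ (fderiv ℝ F) (f x) w w' = 0) → w = 0) :
    criticalSetOfIndex (𝓡 2) (fun y => ⟪v, f y⟫) 1 =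
      f ⁻¹' {p | (∃ c : ℝ, fderiv ℝ F p = c • innerSL ℝ v) ∧
        (∃ w, ⟪v, w⟫ = 0 ∧ fderiv ℝ (fderiv ℝ F) p w w < 0) ∧
          ∃ w, ⟪v, w⟫ = 0 ∧ 0 < fderiv ℝ (fderiv ℝ F) p w w} := by
  have hfs : ∀ x, ContMDiffAt (𝓡 2) 𝓘(ℝ, E) 2 f x := fun x => (hf x).of_le (by norm_cast)
  have hfd : ∀ x, MDifferentiableAt (𝓡 2) 𝓘(ℝ, E) f x := fun x =>
    (hfs x).mdifferentiableAt (by norm_num)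
  have hFx : ∀ x, ContDiffAt ℝ 2 F (f x) := fun x => hF.contDiffAt
  have hFd : ∀ x, DifferentiableAt ℝ F (f x) := fun x => (hFx x).differentiableAt (by norm_num)
  ext x
  simp only [mem_criticalSetOfIndex, mem_preimage, mem_setOf_eq]
  rw [isMCriticalPt_inner_comp_iff (m := 2) hdim (hfd x) (hinj x) (hFd x) hFf (hDF0 x) hv]
  constructor
  · rintro ⟨⟨c, hDF⟩, hidx⟩
    have hc : c ≠ 0 := by rintro rfl; rw [zero_smul] at hDF; exact hDF0 x hDF
    exact ⟨⟨c, hDF⟩, (morseIndex_inner_comp_eq_one_iff hdim (hfs x) (hinj x) (hFx x) hFf hv hc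
      hDF (hsep x c hDF)).1 hidx⟩
  · rintro ⟨⟨c, hDF⟩, hsigns⟩
    have hc : c ≠ 0 := by rintro rfl; rw [zero_smul] at hDF; exact hDF0 x hDF
    exact ⟨⟨c, hDF⟩, (morseIndex_inner_comp_eq_one_iff hdim (hfs x) (hinj x) (hFx x) hFf hv hc
      hDF (hsep x c hDF)).2 hsigns⟩

/-- The number of saddles of the height equals the number of indefinite horizontal points on the
range of `f` (`f` injective). [folklore] -/
theorem ncard_criticalSetOfIndex_one_eq {M : Type*} [TopologicalSpace M]
    [ChartedSpace (EuclideanSpace ℝ (Fin 2)) M] [IsManifold (𝓡 2) 2 M]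
    (hdim : finrank ℝ E = 3) {f : M → E} (hf : ContMDiff (𝓡 2) 𝓘(ℝ, E) ∞ f)
    (hfi : Function.Injective f)
    (hinj : ∀ x, Function.Injective (mfderiv (𝓡 2) 𝓘(ℝ, E) f x)) {F : E → ℝ}
    (hF : ContDiff ℝ 2 F) (hFf : ∀ y, F (f y) = 0) (hDF0 : ∀ y, fderiv ℝ F (f y) ≠ 0)
    {v : E} (hv : v ≠ 0)
    (hsep : ∀ x (c : ℝ), fderiv ℝ F (f x) = c • innerSL ℝ v →
      ∀ w, ⟪v, w⟫ = 0 → (∀ w', ⟪v, w'⟫ = 0 → fderiv ℝ (fderiv ℝ F) (f x) w w' = 0) → w = 0) :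
    (criticalSetOfIndex (𝓡 2) (fun y => ⟪v, f y⟫) 1).ncard =
      {p ∈ range f | (∃ c : ℝ, fderiv ℝ F p = c • innerSL ℝ v) ∧
        (∃ w, ⟪v, w⟫ = 0 ∧ fderiv ℝ (fderiv ℝ F) p w w < 0) ∧
          ∃ w, ⟪v, w⟫ = 0 ∧ 0 < fderiv ℝ (fderiv ℝ F) p w w}.ncard := by
  rw [criticalSetOfIndex_one_eq_preimage hdim hf hinj hF hFf hDF0 hv hsep,
    ← Set.ncard_image_of_injective _ hfi, image_preimage_eq_inter_range]
  congr 1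
  ext p
  simp only [mem_inter_iff, mem_setOf_eq]
  tauto

end Dict

end HeightDictionary

end Literature.Topology.FourManifolds

end
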